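import Literature.NumberTheory.Sieve.HeathBrownCubicETermClassesZero
import Literature.NumberTheory.Sieve.HeathBrownCubicETermMainTerm
import Literature.NumberTheory.Sieve.HeathBrownCubicTypeIIWeightBounds
import HarnessLib

/-!
# Inputs for the assembly of Heath-Brown's Lemma 8.1 (small estimates and the parameters for large `X`)

Companion of `HeathBrownCubicLemma81` (D. R. Heath-Brown, *Primes represented by `x³ + 2y³`*, Acta Math.
186 (2001), 1–84, §8, pp. 47–51), which assembles Lemma 8.1 from the Möbius sums `Σ(x; q)`; this file
PROVES the small inputs of that assembly (all proofs, no definitions, no named facts):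

* `eulerPhiK_pos` (`φ_K(q) ≥ 1`); `abs_cubeIntegral_le`, `abs_cubeIntegral_le'` ("`𝓘 ≪ S₀³(ξ log X)^n`" by
  (8.4), p. 51); `abs_idealMoebius_mul_log_le` (`|μ(J) log(L/N(J))| ≤ log L` for `N(J) < L`);
  `card_smallIdeals_le`;
* `abs_classSum_sub_main_le` — the class estimate (8.5)-summed for EVERY length `k ≥ 1`, unifying
  `abs_sum_dvd_class_wDeriv_sub_le` (`k ≥ 2`) and `abs_sum_dvd_class_wDeriv_sub_le_zero` (`k = 1`):
  `≤ (8424c₃³/c₄ + 108)S₀²(ξ log X)^{k−1}` when `ξ log X ≥ 1` and `S₀V^{−1/3} ≤ 4c₃`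
  (`side_mul_rpow_neg_le`: true for every cube as in Lemma 3.8);
* `mul_exp_neg_le_exp_neg_sqrt` (`ue^{−u} ≤ e^{−c√u}` for `u ≥ (2 + c)²`), `four_le_exp_two`,
  `tendsto_log_hbL_atTop` (`log L → ∞`), **`eventually_lemma81_params`** (for large `X`: `X ≥ 2`,
  `0 < τ ≤ 1/4`, `log L ≥ 2`, `ξ log X ≥ 1`, `(log L)L⁻¹ ≤ exp{−c√(log L)}`);
* `lemma81_decomp` (the bookkeeping identity splitting `∑e − ε·MT` into the class errors and the
  Möbius-sum errors); **`moebiusSum_error_at_divisor`** — the Möbius-sum hypothesis applied at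
  `x = L/N(I)` for `I ∣ (q)`, `q ≤ L^{1/6}` ("since `q ≤ L^{1/6}` we will have `N(IA) ≤ L^{1/2} ≤ L/N(IA)`",
  p. 51): `x ≥ L^{1/2} ≥ 2`, `q³ ≤ x`, and `exp{−c_M√(log x)} ≤ exp{−(c_M/2)√(log L)}`.

## References

* D. R. Heath-Brown, *Primes represented by `x³ + 2y³`*, Acta Math. 186 (2001), 1–84: §8, pp. 50–51.
  [cite: HeathBrownActa2001, §8 pp. 50–51]

## Mathlib / tree search

Mathlib: `Real.log_le_rpow_div`, `Real.exp_one_gt_d9`, `Filter.tendsto_atTop`,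
`Ideal.finiteQuotientOfFreeOfNeBot`, `Nat.card_pos`, `norm_setIntegral_le_of_norm_le_const`. Tree:
`HeathBrownCubicSiegelWalfisz` (`eventually_lemma38_params`, `eventually_mul_loglog_rpow_le`,
`side_pow_three_le_of_cubeCond`, `eulerPhiK`, `cubeIntegral`), `HeathBrownCubicETermClasses(Zero)`,
`HeathBrownCubicETermRearrangement` (`smallIdeals`), `HeathBrownCubicIdealMoebius` (`idealMoebius_bot`),
`HeathBrownCubicCubeSums` (`volume_realCube`), `HeathBrownCubicWCalculus` (`wDeriv_nonneg`, `wDeriv_le`),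
`HeathBrownCubicTypeIIWeightBounds` (`abs_idealMoebius_le`), `HeathBrownCubicTypeII` (`hbL`, `hbXi_pos`).
-/

noncomputable section

open Polynomial NumberField Finset MeasureTheory Filter Topology

namespace Literature.NumberTheory.Sieve.CubicSieve

open LFunctions.CubeRootTwoField CubicPrimes

/-! ### Small inputs: `φ_K(q) > 0`, `|𝓘| ≤ S₀³(ξ log X)^n`, `|μ(J) log(L/N(J))| ≤ log L`, the unified class error -/

section Inputs

variable {X τ : ℝ}

/-- `φ_K(q) ≥ 1` for `q ≥ 1` (the unit class). [folklore] -/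
theorem eulerPhiK_pos {q : ℕ} (hq : 0 < q) : 0 < eulerPhiK q := by
  unfold eulerPhiK
  have h0 : Ideal.span {(q : 𝓞 K)} ≠ ⊥ := by
    rw [Ne, Ideal.span_singleton_eq_bot]; exact_mod_cast hq.ne'
  haveI : Finite (𝓞 K ⧸ Ideal.span {(q : 𝓞 K)}) := Ideal.finiteQuotientOfFreeOfNeBot _ h0
  exact Nat.card_pos

/-- **`|𝓘| ≤ S₀³(ξ log X)^n`** for `𝐦` of length `n + 1`, `X ≥ 1`, `τ ≥ 0`, `S₀ ≥ 0` ((8.4):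
`0 ≤ w' ≤ (ξ log X)^n`, on a cube of volume `S₀³`; "Lemma 8.1 then follows, since (8.4) yields
`𝓘 ≪ S₀³(ξ log X)^n`", p. 51). [cite: HeathBrownActa2001, §8 p. 51] -/
theorem abs_cubeIntegral_le (hX : 1 ≤ X) (hτ : 0 ≤ τ) {n : ℕ} (m : Fin (n + 1) → ℕ) (a : ℝ × ℝ × ℝ)
    {S₀ : ℝ} (hS₀ : 0 ≤ S₀) :
    |cubeIntegral X τ m a S₀| ≤ S₀ ^ 3 * (hbXi τ * Real.log X) ^ n := by
  have hX0 : 0 < X := by linarith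
  have hvol : volume (realCube a S₀) < ⊤ := by rw [volume_realCube a hS₀]; exact ENNReal.ofReal_lt_top
  have h := norm_setIntegral_le_of_norm_le_const hvol (f := fun p => wDeriv X τ m (normForm p))
    (C := (hbXi τ * Real.log X) ^ n) (fun p _ => by
      rw [Real.norm_eq_abs, abs_of_nonneg (wDeriv_nonneg hX0 m _)]; exact wDeriv_le hX hτ m _)
  rw [Real.norm_eq_abs, measureReal_def, volume_realCube a hS₀, ENNReal.toReal_ofReal (by positivity)] at h
  unfold cubeIntegral
  linarith [h]

/-- `|𝓘| ≤ S₀³(ξ log X)^{k−1}` for `𝐦` of any length `k ≥ 1`. [cite: HeathBrownActa2001, §8 p. 51] -/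
theorem abs_cubeIntegral_le' (hX : 1 ≤ X) (hτ : 0 ≤ τ) {k : ℕ} (hk : 0 < k) (m : Fin k → ℕ)
    (a : ℝ × ℝ × ℝ) {S₀ : ℝ} (hS₀ : 0 ≤ S₀) :
    |cubeIntegral X τ m a S₀| ≤ S₀ ^ 3 * (hbXi τ * Real.log X) ^ (k - 1) := by
  obtain ⟨n, rfl⟩ : ∃ n, k = n + 1 := ⟨k - 1, (Nat.succ_pred_eq_of_pos hk).symm⟩
  simpa using abs_cubeIntegral_le hX hτ m a hS₀

/-- For `N(J) < L` (and `L ≥ 1`): `|μ(J) log(L/N(J))| ≤ log L` (`|μ| ≤ 1`, `μ(0) = 0`, and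
`1 ≤ N(J) < L` otherwise). [folklore] -/
theorem abs_idealMoebius_mul_log_le {L : ℝ} (hL : 1 ≤ L) {J : Ideal (𝓞 K)} (hJ : J ∈ smallIdeals L) :
    |idealMoebius J * Real.log (L / Ideal.absNorm J)| ≤ Real.log L := by
  by_cases hJ0 : J = ⊥
  · rw [hJ0, idealMoebius_bot, zero_mul, abs_zero]; exact Real.log_nonneg hL
  · have hN1 : (1 : ℝ) ≤ Ideal.absNorm J := by
      exact_mod_cast Nat.pos_of_ne_zero fun h => hJ0 (Ideal.absNorm_eq_zero_iff.mp h)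
    have hNL : (Ideal.absNorm J : ℝ) < L := mem_smallIdeals_iff.mp hJ
    have hlog0 : 0 ≤ Real.log (L / Ideal.absNorm J) :=
      Real.log_nonneg ((one_le_div (by linarith)).mpr hNL.le)
    have hlogL : Real.log (L / Ideal.absNorm J) ≤ Real.log L := by
      apply Real.log_le_log (by positivity)
      exact div_le_self (by linarith) hN1
    rw [abs_mul, abs_of_nonneg hlog0]
    calc |idealMoebius J| * Real.log (L / Ideal.absNorm J) ≤ 1 * Real.log (L / Ideal.absNorm J) :=
          mul_le_mul_of_nonneg_right (abs_idealMoebius_le J) hlog0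
      _ ≤ Real.log L := by rw [one_mul]; exact hlogL

/-- `#{J : N(J) < L} ≤ #{J : N(J) ≤ ⌊L⌋}`. [folklore] -/
theorem card_smallIdeals_le (L : ℝ) : (smallIdeals L).card ≤ (idealsLE ⌊L⌋₊).card := by
  classical
  unfold smallIdeals
  exact Finset.card_filter_le _ _

open scoped Classical in
/-- **The class estimate for every length `k ≥ 1`, unified** (from `abs_sum_dvd_class_wDeriv_sub_le` for
`k ≥ 2` and `abs_sum_dvd_class_wDeriv_sub_le_zero` for `k = 1`): for a cube as in Lemma 3.8 with moreover
`S₀ ≤ 4c₃V^{1/3}` (true for any such cube, `side_pow_three_le_of_cubeCond`) and `ξ log X ≥ 1`,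
`|∑_{β̂ ∈ 𝒞, J ∣ β, β ≡ α (mod q)} w'(N(β)) − [α ∈ J + (q)]·N(J ∩ (q))⁻¹𝓘| ≤ (8424c₃³/c₄ + 108)S₀²(ξ log X)^{k−1}`.
[cite: HeathBrownActa2001, §8 (8.5)] -/
theorem abs_classSum_sub_main_le (hX : 1 ≤ X) (hτ : 0 ≤ τ) (hL : 1 ≤ hbXi τ * Real.log X)
    {k : ℕ} (hk : 0 < k) (m : Fin k → ℕ)
    {c₃ c₄ V : ℝ} (hc₃ : 0 < c₃) (hc₄ : 0 < c₄) (hV : 0 < V) {a : ℝ × ℝ × ℝ} {S₀ : ℝ}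
    (hcube : CubeCond c₃ c₄ V a S₀) (hSV : S₀ * V ^ (-(1 / 3 : ℝ)) ≤ 4 * c₃)
    {J : Ideal (𝓞 K)} (hJ : J ≠ ⊥) {q : ℕ} (hq : 0 < q)
    (hJq : (Ideal.absNorm J : ℝ) * (q : ℝ) ^ 3 ≤ S₀) (α : 𝓞 K) :
    |∑ v ∈ ((latticeCube a S₀).filter (fun v => (q : 𝓞 K) ∣ coordElt v - α)).filter
          (fun v => J ∣ Ideal.span {coordElt v}),
          wDeriv X τ m (Ideal.absNorm (Ideal.span {coordElt v})) -
        (if α ∈ J ⊔ Ideal.span {(q : 𝓞 K)} then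
          ((Ideal.absNorm (J ⊓ Ideal.span {(q : 𝓞 K)}) : ℝ))⁻¹ * cubeIntegral X τ m a S₀ else 0)| ≤
      (8424 * (c₃ ^ 3 / c₄) + 108) * S₀ ^ 2 * (hbXi τ * Real.log X) ^ (k - 1) := by
  have hS₀ : 0 ≤ S₀ := by
    have hJ1 : (1 : ℝ) ≤ Ideal.absNorm J := by
      exact_mod_cast Nat.pos_of_ne_zero fun h => hJ (Ideal.absNorm_eq_zero_iff.mp h)
    have hq1 : (1 : ℝ) ≤ (q : ℝ) ^ 3 := one_le_pow₀ (by exact_mod_cast hq)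
    nlinarith
  set 𝔏 := hbXi τ * Real.log X with h𝔏
  have h𝔏0 : 0 ≤ 𝔏 := zero_le_one.trans hL
  obtain ⟨n, rfl⟩ : ∃ n, k = n + 1 := ⟨k - 1, (Nat.succ_pred_eq_of_pos hk).symm⟩
  rcases n with _ | n
  · -- `k = 1`
    refine (abs_sum_dvd_class_wDeriv_sub_le_zero hX hτ m hc₃ hc₄ hV hcube hJ hq hJq α).trans ?_
    simp only [Nat.add_sub_cancel, pow_zero, mul_one]
    have : 2808 * (c₃ ^ 3 / c₄) + 108 ≤ 8424 * (c₃ ^ 3 / c₄) + 108 := by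
      have : 0 ≤ c₃ ^ 3 / c₄ := by positivity
      linarith
    exact mul_le_mul_of_nonneg_right this (sq_nonneg _)
  · -- `k = n + 2`
    refine (abs_sum_dvd_class_wDeriv_sub_le hX hτ m hc₄ hV hcube hJ hq hJq α).trans ?_
    simp only [Nat.add_sub_cancel]
    -- `S₀³V^{-1/3} ≤ 4c₃S₀²` and `𝔏^n ≤ 𝔏^{n+1}`
    have h1 : S₀ ^ 3 * V ^ (-(1 / 3 : ℝ)) ≤ 4 * c₃ * S₀ ^ 2 := by
      have := mul_le_mul_of_nonneg_left hSV (sq_nonneg S₀)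
      calc S₀ ^ 3 * V ^ (-(1 / 3 : ℝ)) = S₀ ^ 2 * (S₀ * V ^ (-(1 / 3 : ℝ))) := by ring
        _ ≤ S₀ ^ 2 * (4 * c₃) := this
        _ = 4 * c₃ * S₀ ^ 2 := by ring
    have h2 : 𝔏 ^ n ≤ 𝔏 ^ (n + 1) := pow_le_pow_right₀ hL (Nat.le_succ n)
    have hc : 0 ≤ c₃ ^ 2 / c₄ := by positivity
    calc 2106 * (c₃ ^ 2 / c₄) * S₀ ^ 3 * V ^ (-(1 / 3 : ℝ)) * 𝔏 ^ n + 108 * S₀ ^ 2 * 𝔏 ^ (n + 1)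
        = 2106 * (c₃ ^ 2 / c₄) * (S₀ ^ 3 * V ^ (-(1 / 3 : ℝ))) * 𝔏 ^ n + 108 * S₀ ^ 2 * 𝔏 ^ (n + 1) := by ring
      _ ≤ 2106 * (c₃ ^ 2 / c₄) * (4 * c₃ * S₀ ^ 2) * 𝔏 ^ (n + 1) + 108 * S₀ ^ 2 * 𝔏 ^ (n + 1) := by
          gcongr
      _ = (8424 * (c₃ ^ 3 / c₄) + 108) * S₀ ^ 2 * 𝔏 ^ (n + 1) := by
          field_simp
          ring

end Inputs

/-! ### The parameters for large `X` -/

section Params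

/-- `u e^{−u} ≤ e^{−c√u}` for `u ≥ (2 + c)²` (`log u ≤ 2√u`). [folklore] -/
theorem mul_exp_neg_le_exp_neg_sqrt {c u : ℝ} (hc : 0 ≤ c) (hu : (2 + c) ^ 2 ≤ u) :
    u * Real.exp (-u) ≤ Real.exp (-(c * Real.sqrt u)) := by
  have hu0 : 0 < u := lt_of_lt_of_le (by positivity) hu
  have hsqrt : 2 + c ≤ Real.sqrt u := Real.le_sqrt_of_sq_le hu
  have hlog : Real.log u ≤ 2 * Real.sqrt u := by
    have := Real.log_le_rpow_div hu0.le (show (0 : ℝ) < 1 / 2 by norm_num)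
    rw [Real.sqrt_eq_rpow]
    linarith
  have hsu : Real.sqrt u * Real.sqrt u = u := Real.mul_self_sqrt hu0.le
  rw [← Real.exp_log hu0, ← Real.exp_add]
  refine Real.exp_le_exp.mpr ?_
  rw [Real.exp_log hu0]
  nlinarith [Real.sqrt_nonneg u, mul_le_mul_of_nonneg_left hsqrt (Real.sqrt_nonneg u)]

/-- `4 ≤ e²`. [folklore] -/
theorem four_le_exp_two : (4 : ℝ) ≤ Real.exp 2 := by
  have h1 : (2 : ℝ) < Real.exp 1 := lt_trans (by norm_num) Real.exp_one_gt_d9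
  have h2 : Real.exp 2 = Real.exp 1 * Real.exp 1 := by rw [← Real.exp_add]; norm_num
  rw [h2]
  nlinarith [Real.exp_pos (1 : ℝ)]

/-- `log L → ∞` with `X` (`log L = (τ/2) log X = (log log X)^{−ϖ}(log X)/2`). [folklore] -/
theorem tendsto_log_hbL_atTop (ϖ : ℝ) :
    Tendsto (fun X : ℝ => Real.log (hbL X (hbTau ϖ X))) atTop atTop := by
  refine tendsto_atTop.mpr fun b => ?_
  have hT : Tendsto (fun X : ℝ => Real.log (Real.log X)) atTop atTop :=
    Real.tendsto_log_atTop.comp Real.tendsto_log_atTop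
  filter_upwards [eventually_gt_atTop (1 : ℝ), hT.eventually (eventually_gt_atTop (0 : ℝ)),
    eventually_mul_loglog_rpow_le ϖ (2 * max b 0)] with X hX1 hM0 h
  have hX0 : 0 < X := by linarith
  set Mx := Real.log (Real.log X) with hMx
  have hτ : hbTau ϖ X = Mx ^ (-ϖ) := rfl
  have hL : Real.log (hbL X (hbTau ϖ X)) = hbTau ϖ X / 2 * Real.log X := by rw [hbL, Real.log_rpow hX0]
  have hτpos : 0 < hbTau ϖ X := by rw [hτ]; exact Real.rpow_pos_of_pos hM0 _
  have key : hbTau ϖ X * Mx ^ ϖ = 1 := by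
    rw [hτ, ← Real.rpow_add hM0, neg_add_cancel, Real.rpow_zero]
  rw [hL]
  have : hbTau ϖ X * (2 * max b 0 * Mx ^ ϖ) ≤ hbTau ϖ X * Real.log X :=
    mul_le_mul_of_nonneg_left h hτpos.le
  have h2 : hbTau ϖ X * (2 * max b 0 * Mx ^ ϖ) = 2 * max b 0 := by
    calc hbTau ϖ X * (2 * max b 0 * Mx ^ ϖ) = 2 * max b 0 * (hbTau ϖ X * Mx ^ ϖ) := by ring
      _ = 2 * max b 0 := by rw [key, mul_one]
  linarith [le_max_left b 0]

/-- **The parameters of Lemma 8.1 for large `X`** (`τ = (log log X)^{−ϖ}`, `ξ = τ⁵`, `L = X^{τ/2}`):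
eventually `X ≥ 2`, `0 < τ ≤ 1/4`, `log L ≥ 2` (so `L ≥ 4`), `ξ log X ≥ 1`, and
`(log L)·L⁻¹ ≤ exp{−c√(log L)}`. [folklore] -/
theorem eventually_lemma81_params {ϖ : ℝ} (hϖ0 : 0 < ϖ) {c : ℝ} (hc : 0 < c) :
    ∀ᶠ X : ℝ in atTop,
      2 ≤ X ∧ 0 < hbTau ϖ X ∧ hbTau ϖ X ≤ 1 / 4 ∧ 2 ≤ Real.log (hbL X (hbTau ϖ X)) ∧
        1 ≤ hbXi (hbTau ϖ X) * Real.log X ∧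
        Real.log (hbL X (hbTau ϖ X)) * Real.exp (-Real.log (hbL X (hbTau ϖ X))) ≤
          Real.exp (-(c * Real.sqrt (Real.log (hbL X (hbTau ϖ X))))) := by
  have hT : Tendsto (fun X : ℝ => Real.log (Real.log X)) atTop atTop :=
    Real.tendsto_log_atTop.comp Real.tendsto_log_atTop
  filter_upwards [eventually_lemma38_params hϖ0 0 0 hc, hT.eventually (eventually_gt_atTop (0 : ℝ)),
    eventually_mul_loglog_rpow_le (5 * ϖ) 1,
    (tendsto_log_hbL_atTop ϖ).eventually (eventually_ge_atTop (max 2 ((2 + c) ^ 2)))]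
    with X h38 hM0 h5 hℓ
  obtain ⟨hX2, hτ0, hτ4, -, -, -, -⟩ := h38
  have hX0 : 0 < X := by linarith
  set Mx := Real.log (Real.log X) with hMx
  refine ⟨hX2, hτ0, hτ4, le_trans (le_max_left _ _) hℓ, ?_, ?_⟩
  · -- `ξ log X = M^{-5ϖ} log X ≥ 1`
    have hτ : hbTau ϖ X = Mx ^ (-ϖ) := rfl
    have hξ : hbXi (hbTau ϖ X) = Mx ^ (-(5 * ϖ)) := by
      rw [hbXi, hτ, ← Real.rpow_natCast, ← Real.rpow_mul hM0.le]; ring_nf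
    have key : hbXi (hbTau ϖ X) * Mx ^ (5 * ϖ) = 1 := by
      rw [hξ, ← Real.rpow_add hM0, neg_add_cancel, Real.rpow_zero]
    have hξpos : 0 < hbXi (hbTau ϖ X) := hbXi_pos hτ0
    rw [one_mul] at h5
    calc (1 : ℝ) = hbXi (hbTau ϖ X) * Mx ^ (5 * ϖ) := key.symm
      _ ≤ hbXi (hbTau ϖ X) * Real.log X := mul_le_mul_of_nonneg_left h5 hξpos.le
  · exact mul_exp_neg_le_exp_neg_sqrt hc.le (le_trans (le_max_right _ _) hℓ)

end Params

/-! ### The bookkeeping identity, the Möbius sums at `x = L/N(I)`, the cube side -/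

section MainInputs

/-- The bookkeeping identity behind Lemma 8.1: with `P = M(ξ log X)^{n+1}`, the main term of (8.1)
written through (8.7), and `ε = ∑_{I ∣ (q), α ∈ I} μ(I)`,
`P⁻¹∑_J w_J S_J − ε·𝓘/(γφ·P) = P⁻¹∑_J w_J(S_J − m_J) + P⁻¹𝓘q⁻³∑_I μ(I)(Σ_I − q³/(γφ))`. [folklore] -/
theorem lemma81_decomp {ι κ : Type*} (s : Finset ι) (D : Finset κ) (w S mn ind : ι → ℝ)
    (μ Sg : κ → ℝ) {P 𝓘 q3 γφ ε : ℝ} (hP : P ≠ 0) (hq3 : q3 ≠ 0) (hγφ : γφ ≠ 0)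
    (hmn : ∀ J, w J * mn J = 𝓘 * (w J * ind J))
    (hmain : ∑ J ∈ s, w J * ind J = q3⁻¹ * ∑ I ∈ D, μ I * Sg I) (hε : ε = ∑ I ∈ D, μ I) :
    P⁻¹ * ∑ J ∈ s, w J * S J - ε * (𝓘 / (γφ * P)) =
      P⁻¹ * ∑ J ∈ s, w J * (S J - mn J) + P⁻¹ * 𝓘 * q3⁻¹ * ∑ I ∈ D, μ I * (Sg I - q3 / γφ) := by
  have hsplit : ∑ J ∈ s, w J * S J = ∑ J ∈ s, w J * (S J - mn J) + 𝓘 * ∑ J ∈ s, w J * ind J := by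
    rw [Finset.mul_sum, ← Finset.sum_add_distrib]
    refine Finset.sum_congr rfl fun J _ => ?_
    rw [← hmn]; ring
  have hR : ∑ I ∈ D, μ I * (Sg I - q3 / γφ) = ∑ I ∈ D, μ I * Sg I - q3 / γφ * ∑ I ∈ D, μ I := by
    rw [Finset.mul_sum, ← Finset.sum_sub_distrib]
    refine Finset.sum_congr rfl fun I _ => ?_
    ring
  rw [hsplit, hmain, hε, hR]
  field_simp
  ring

open scoped Classical in
/-- The Möbius-sum hypothesis applied at `x = L/N(I)` for a divisor `I` of `(q)`, `q ≤ L^{1/6}`, `L ≥ 4`: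
"since `q ≤ L^{1/6}`, we will have `N(IA) ≤ L^{1/2} ≤ L/N(IA)`" (p. 51), so `x ≥ L^{1/2} ≥ 2`, `q³ ≤ x`,
and `exp{−c_M√(log x)} ≤ exp{−(c_M/2)√(log L)}`. [cite: HeathBrownActa2001, §8 p. 51] -/
theorem moebiusSum_error_at_divisor {C_M c_M : ℝ} (hc_M : 0 < c_M)
    (HMS : ∀ x : ℝ, 2 ≤ x → ∀ q : ℕ, 1 ≤ q → (q : ℝ) ^ 3 ≤ x →
      |∑ A ∈ (smallIdeals x).filter (fun A => A ⊔ Ideal.span {(q : 𝓞 K)} = ⊤),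
          idealMoebius A * Real.log (x / Ideal.absNorm A) / Ideal.absNorm A -
        (q : ℝ) ^ 3 / (gamma₀ * eulerPhiK q)| ≤ C_M * Real.exp (-(c_M * Real.sqrt (Real.log x))))
    {L : ℝ} (hL4 : 4 ≤ L) {q : ℕ} (hq1 : 1 ≤ q) (hq6 : (q : ℝ) ^ 6 ≤ L)
    (hq3 : (q : ℝ) ^ 3 ≤ L ^ (1 / 2 : ℝ)) {I : Ideal (𝓞 K)} (hI0 : I ≠ ⊥)
    (hNIq : (Ideal.absNorm I : ℝ) ≤ (q : ℝ) ^ 3) :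
    |∑ A ∈ (smallIdeals (L / Ideal.absNorm I)).filter (fun A => A ⊔ Ideal.span {(q : 𝓞 K)} = ⊤),
          idealMoebius A * Real.log (L / Ideal.absNorm I / Ideal.absNorm A) / Ideal.absNorm A -
        (q : ℝ) ^ 3 / (gamma₀ * eulerPhiK q)| ≤
      max C_M 0 * Real.exp (-(c_M / 2 * Real.sqrt (Real.log L))) := by
  have hLpos : 0 < L := by linarith
  have hL1 : 1 ≤ L := by linarith
  have hNI1 : (1 : ℝ) ≤ Ideal.absNorm I := by
    exact_mod_cast Nat.pos_of_ne_zero fun h => hI0 (Ideal.absNorm_eq_zero_iff.mp h)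
  have hNIpos : (0 : ℝ) < Ideal.absNorm I := by linarith
  have hLhalf : L ^ (1 / 2 : ℝ) * L ^ (1 / 2 : ℝ) = L := by rw [← Real.rpow_add hLpos]; norm_num
  have hL2half : (2 : ℝ) ≤ L ^ (1 / 2 : ℝ) := by
    by_contra h
    have h' : L ^ (1 / 2 : ℝ) < 2 := lt_of_not_ge h
    have := mul_lt_mul'' h' h' (by positivity) (by positivity)
    linarith
  set x := L / Ideal.absNorm I with hxdef
  have hxL : L ^ (1 / 2 : ℝ) ≤ x := by
    rw [hxdef, le_div_iff₀ hNIpos]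
    calc L ^ (1 / 2 : ℝ) * Ideal.absNorm I ≤ L ^ (1 / 2 : ℝ) * (q : ℝ) ^ 3 :=
          mul_le_mul_of_nonneg_left hNIq (by positivity)
      _ ≤ L ^ (1 / 2 : ℝ) * L ^ (1 / 2 : ℝ) := mul_le_mul_of_nonneg_left hq3 (by positivity)
      _ = L := hLhalf
  have hx2 : 2 ≤ x := hL2half.trans hxL
  have hqx : (q : ℝ) ^ 3 ≤ x := by
    rw [hxdef, le_div_iff₀ hNIpos]
    calc (q : ℝ) ^ 3 * Ideal.absNorm I ≤ (q : ℝ) ^ 3 * (q : ℝ) ^ 3 :=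
          mul_le_mul_of_nonneg_left hNIq (by positivity)
      _ = (q : ℝ) ^ 6 := by ring
      _ ≤ L := hq6
  have hMSx := HMS x hx2 q hq1 hqx
  -- `c_M √(log x) ≥ (c_M/2) √(log L)` since `log x ≥ (log L)/2`
  set ℓ := Real.log L with hℓ
  have hℓ0 : 0 ≤ ℓ := Real.log_nonneg hL1
  have hlogx : ℓ / 2 ≤ Real.log x := by
    have : Real.log (L ^ (1 / 2 : ℝ)) = ℓ / 2 := by rw [Real.log_rpow hLpos]; ring
    rw [← this]
    exact Real.log_le_log (by positivity) hxL
  have hA : Real.sqrt ℓ ≤ 2 * Real.sqrt (ℓ / 2) := by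
    have h1 : 0 ≤ 2 * Real.sqrt (ℓ / 2) := by positivity
    refine (pow_le_pow_iff_left₀ (Real.sqrt_nonneg ℓ) h1 two_ne_zero).mp ?_
    rw [mul_pow, Real.sq_sqrt hℓ0, Real.sq_sqrt (by positivity)]
    linarith
  have hB : Real.sqrt (ℓ / 2) ≤ Real.sqrt (Real.log x) := Real.sqrt_le_sqrt hlogx
  have hC : c_M / 2 * Real.sqrt ℓ ≤ c_M * Real.sqrt (Real.log x) := by
    calc c_M / 2 * Real.sqrt ℓ ≤ c_M / 2 * (2 * Real.sqrt (ℓ / 2)) :=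
          mul_le_mul_of_nonneg_left hA (by positivity)
      _ = c_M * Real.sqrt (ℓ / 2) := by ring
      _ ≤ c_M * Real.sqrt (Real.log x) := mul_le_mul_of_nonneg_left hB hc_M.le
  have hexp : Real.exp (-(c_M * Real.sqrt (Real.log x))) ≤ Real.exp (-(c_M / 2 * Real.sqrt ℓ)) :=
    Real.exp_le_exp.mpr (neg_le_neg hC)
  calc _ ≤ C_M * Real.exp (-(c_M * Real.sqrt (Real.log x))) := hMSx
    _ ≤ max C_M 0 * Real.exp (-(c_M * Real.sqrt (Real.log x))) :=
        mul_le_mul_of_nonneg_right (le_max_left _ _) (Real.exp_pos _).le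
    _ ≤ max C_M 0 * Real.exp (-(c_M / 2 * Real.sqrt ℓ)) :=
        mul_le_mul_of_nonneg_left hexp (le_max_right _ _)

/-- `S₀V^{−1/3} ≤ 4c₃` for a cube as in Lemma 3.8 (`S₀³ ≤ 64c₃³V`, `side_pow_three_le_of_cubeCond`).
[cite: HeathBrownActa2001, Lemma 3.8] -/
theorem side_mul_rpow_neg_le {c₃ c₄ V : ℝ} (hc₃ : 0 < c₃) {a : ℝ × ℝ × ℝ} {S₀ : ℝ} (hS₀ : 0 < S₀)
    (hV : 0 < V) (h : CubeCond c₃ c₄ V a S₀) : S₀ * V ^ (-(1 / 3 : ℝ)) ≤ 4 * c₃ := by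
  have h3 := side_pow_three_le_of_cubeCond hS₀ hV.le h
  have hV3 : (V ^ (1 / 3 : ℝ)) ^ 3 = V := by
    rw [← Real.rpow_natCast, ← Real.rpow_mul hV.le]; norm_num
  have hle : S₀ ≤ 4 * c₃ * V ^ (1 / 3 : ℝ) := by
    have h' : S₀ ^ 3 ≤ (4 * c₃ * V ^ (1 / 3 : ℝ)) ^ 3 := by
      calc S₀ ^ 3 ≤ 64 * c₃ ^ 3 * V := h3
        _ = (4 * c₃ * V ^ (1 / 3 : ℝ)) ^ 3 := by rw [mul_pow, mul_pow, hV3]; norm_num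
    exact le_of_pow_le_pow_left₀ three_ne_zero (by positivity) h'
  have hVneg : V ^ (-(1 / 3 : ℝ)) = (V ^ (1 / 3 : ℝ))⁻¹ := Real.rpow_neg hV.le _
  have hV13 : 0 < V ^ (1 / 3 : ℝ) := Real.rpow_pos_of_pos hV _
  rw [hVneg, ← div_eq_mul_inv, div_le_iff₀ hV13]
  exact hle

end MainInputs

end Literature.NumberTheory.Sieve.CubicSieve

end
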